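import Summits.CriticalPhenomena.PercolationContinuityZ3.Theses.PercLowPointHalfSpace
import Summits.CriticalPhenomena.PercolationContinuityZ3.Theorems.PercLowPointHalfSpaceQuantitativeBGNKlTransfer
import Summits.CriticalPhenomena.PercolationContinuityZ3.Theorems.PercLowPointHalfSpaceQuantitativeBGNMirrorSymm
import Summits.CriticalPhenomena.PercolationContinuityZ3.Theorems.PercLowPointHalfSpaceQuantitativeBGNMirrorTwoGhost
import Summits.CriticalPhenomena.PercolationContinuityZ3.Theorems.PercLowPointHalfSpaceQuantitativeBGNMirrorSealing
import Summits.CriticalPhenomena.PercolationContinuityZ3.Theorems.QuantitativeBGN.Negative.LoadBearing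
import Literature.Probability.Percolation.TwoGhostInequalityProofs
import Literature.Probability.Percolation.FiniteEnergy
import Literature.Probability.Percolation.CriticalContinuityProofs
import HarnessLib

/-!
# Crux `PercLowPointHalfSpace.QuantitativeBGN` (stmt-CriticalPhenomena-0913), line
# `mirror-akn-two-arm-import` — the transfer: `MirrorNonCoalescence(b < 1/2) ⇒ QuantitativeBGN`

Lead prover's file for the crux skeleton `Cruxes/QuantitativeBGN/Lines/mirror_akn_two_arm_import.lean`
(continuation lead prover-line-stmt-CriticalPhenomena-0913-c1-0); lands with
`--supports stmt-CriticalPhenomena-0913`. With the two landed stubs `stub_mirrorSymm` (both mirror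
half-space volume events have probability `w_p(n) = P^H_p(|C_H(o)| ≥ n)`) and `stub_mirrorTwoGhost`
(the squared-and-distinct event lies in Hutchcroft's `𝒮_{e,n}`), the composition of the line is
sorry-free MODULO its single open stub `stub_mirrorNonCoalescence`. This file records:

* `QuantitativeBGNMirrorTransfer.mirrorIndep` — `P(volUp n ∩ volDn n) = P(volUp n) P(volDn n)`
  (disjoint edge sets, `bondPercolation_real_inter_of_disjoint`).
* `QuantitativeBGNMirrorTransfer.twoGhost_bound` — `P_p(𝒮_{e,n}) ≤ 66·(2·3)·√((1−p)/(pn))`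
  (`Hutchcroft2020_twoGhost_corollary_holds`, PROVED in tree) and the algebra
  `tail_bound_of_sq_bound`, `sqrt_ratio_le`.
* `QuantitativeBGNMirrorTransfer.volumeTail_of_nonCoalescenceAt` — at ANY `p ∈ (0,1]`, mirror
  non-coalescence with exponent `b` gives the volume tail `w_p(n) ≤ √(K/c) n^{-(1/2−b)/2}`.
* `quantitativeBGN_of_mirrorNonCoalescence` — **`MirrorNonCoalescence(b < 1/2)` at `p_c` ⇒
  `QuantitativeBGN`** with `a = (1/2 − b)/2` (through the landed station
  `quantitativeBGN_of_surfaceVolumeTail`). The hypothesis is the registered open stub, VERBATIM.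
* `mirrorNonCoalescence_false_of_criticalProb_lt` — the same hypothesis at any `p > p_c(ℤ³)` is
  FALSE (it would give a polynomial half-space arm decay above `p_c`, refuted by
  `Negative.quantitativeBGNAt_false_of_criticalProb_lt`): any proof of the stub must use `p ≤ p_c`.
* `mirror_thinFoot_bound` — UNCONDITIONAL: for `0 < p`, `n ≥ 1` and every `k`,
  `(1 − p)^k · P_p(volDn n ∩ footLe k)² ≤ 396 √((1−p)/(pn))`: large half-space clusters with thin feet
  are polynomially rare (sealing `mirror_sealing_bound` + STUBS 1–2 + two-ghost). At `p_c` this is the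
  calibration "bounded feet cannot carry the stub": its content is non-coalescence of clusters whose
  feet have `≳ log n` sites.

No new definitions (events expanded over existing declarations).
-/

noncomputable section

namespace Summit.CriticalPhenomena.PercolationContinuityZ3.Theorems

open MeasureTheory Filter
open Literature.Probability.Percolation Literature.Probability.LatticeModels
open scoped ENNReal Topology

namespace QuantitativeBGNMirrorTransfer

/-! ### Independence of the two mirror volume events -/

/-- **Mirror independence**: `P_p(volUp n ∩ volDn n) = P_p(volUp n) · P_p(volDn n)` — the two events are
determined by the disjoint edge sets of the step graphs of `{x₀ ≥ 1}` and `{x₀ ≤ 0}`. -/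
theorem mirrorIndep (p : unitInterval) (n : ℕ) :
    (bondPercolation (zdGraph 3) p).real
        ({ω | (n : ℕ∞) ≤ (openClusterIn (withinGraph (zdGraph 3) {x : Site 3 | 1 ≤ x 0}) ω (Pi.single 0 1)).encard} ∩
          {ω | (n : ℕ∞) ≤ (openClusterIn (withinGraph (zdGraph 3) {x : Site 3 | x 0 ≤ 0}) ω 0).encard}) =
      (bondPercolation (zdGraph 3) p).real
          {ω | (n : ℕ∞) ≤ (openClusterIn (withinGraph (zdGraph 3) {x : Site 3 | 1 ≤ x 0}) ω (Pi.single 0 1)).encard} *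
        (bondPercolation (zdGraph 3) p).real
          {ω | (n : ℕ∞) ≤ (openClusterIn (withinGraph (zdGraph 3) {x : Site 3 | x 0 ≤ 0}) ω 0).encard} :=
  bondPercolation_real_inter_of_disjoint (zdGraph 3) p MirrorSealing.disjoint_edgeSet_up_dn
    (MirrorSealing.determinedBy_volUp n)
    (MirrorSealing.determinedBy_setOf_openClusterIn (fun C => (n : ℕ∞) ≤ C.encard))
    (MirrorSealing.measurableSet_volUp n) (MirrorSealing.measurableSet_volDn n)

/-! ### The two-ghost bound at the edge `{0, e₀}` and the squaring algebra -/

/-- `0 ∼ e₀` in `ℤ³`. -/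
theorem adj_zero_e0 : (zdGraph 3).Adj (0 : Site 3) (Pi.single 0 1) :=
  (zdGraph_adj_iff _ _).2 ⟨0, Or.inl (by simp)⟩

/-- **Two-ghost bound** (Hutchcroft 2020 Cor. 1.7, proved in tree) at the edge `{0, e₀}` of `ℤ³`:
`P_p(𝒮_{e,n}) ≤ 66·(2·3)·√((1−p)/(pn))` for `p > 0`, `n ≥ 1`.
[cite: Hutchcroft2020Locality, Corollary 1.7] -/
theorem twoGhost_bound (p : unitInterval) (hp : 0 < (p : ℝ)) (n : ℕ) (hn : 1 ≤ n) :
    (bondPercolation (zdGraph 3) p).real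
        {ω | s((0 : Site 3), (Pi.single 0 1 : Site 3)) ∉ ω ∧ ¬ (openGraph ω).Reachable (0 : Site 3) (Pi.single 0 1) ∧
          (n : ℕ∞) ≤ {e ∈ (zdGraph 3).edgeSet | ∃ v ∈ e, v ∈ openCluster ω (0 : Site 3)}.encard ∧
          (n : ℕ∞) ≤ {e ∈ (zdGraph 3).edgeSet | ∃ v ∈ e, v ∈ openCluster ω (Pi.single 0 1 : Site 3)}.encard ∧
          ((openCluster ω (0 : Site 3)).Finite ∨ (openCluster ω (Pi.single 0 1 : Site 3)).Finite)} ≤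
      66 * (2 * (3 : ℝ)) * Real.sqrt ((1 - (p : ℝ)) / ((p : ℝ) * n)) :=
  Hutchcroft2020_twoGhost_corollary_holds 3 (by norm_num) p hp n hn 0 (Pi.single 0 1) adj_zero_e0

/-- `√((1−p)/(pn)) ≤ √(1/p) · n^{-1/2}` for real `p > 0` and `n ≥ 1`. -/
theorem sqrt_ratio_le (p : ℝ) (hp : 0 < p) (n : ℕ) (hn : 1 ≤ n) :
    Real.sqrt ((1 - p) / (p * n)) ≤ Real.sqrt (1 / p) * (n : ℝ) ^ (-(1 / 2 : ℝ)) := by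
  have hn0 : (0 : ℝ) < n := by exact_mod_cast hn
  have e1 : (n : ℝ) ^ (-(1 / 2 : ℝ)) = Real.sqrt ((n : ℝ)⁻¹) := by
    rw [Real.sqrt_eq_rpow, ← Real.rpow_neg_one, ← Real.rpow_mul hn0.le]
    norm_num
  rw [e1, ← Real.sqrt_mul (by positivity)]
  apply Real.sqrt_le_sqrt
  rw [div_le_iff₀ (by positivity)]
  have : 1 / p * (n : ℝ)⁻¹ * (p * n) = 1 := by field_simp
  rw [this]
  linarith

/-- **From a squared bound to a tail bound**: if `0 ≤ w`, `0 < c`, `0 ≤ K` and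
`c n^{-b} w² ≤ K n^{-s}` with `n ≥ 1`, then `w ≤ √(K/c) · n^{-(s−b)/2}`. -/
theorem tail_bound_of_sq_bound {w c K b s : ℝ} {n : ℕ} (hn : 1 ≤ n) (hw : 0 ≤ w) (hc : 0 < c)
    (hK : 0 ≤ K) (h : c * (n : ℝ) ^ (-b) * w ^ 2 ≤ K * (n : ℝ) ^ (-s)) :
    w ≤ Real.sqrt (K / c) * (n : ℝ) ^ (-((s - b) / 2)) := by
  have hn0 : (0 : ℝ) < n := by exact_mod_cast hn
  have hnb : 0 < (n : ℝ) ^ (-b) := Real.rpow_pos_of_pos hn0 _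
  have h2 : w ^ 2 ≤ K / c * (n : ℝ) ^ (b - s) := by
    have e : K / c * (n : ℝ) ^ (b - s) = K * (n : ℝ) ^ (-s) / (c * (n : ℝ) ^ (-b)) := by
      rw [show b - s = -s - -b by ring, Real.rpow_sub hn0]
      field_simp
    rw [e, le_div_iff₀ (mul_pos hc hnb)]
    linarith [h]
  have h3 : Real.sqrt (w ^ 2) ≤ Real.sqrt (K / c * (n : ℝ) ^ (b - s)) := Real.sqrt_le_sqrt h2
  rw [Real.sqrt_sq hw] at h3
  refine h3.trans (le_of_eq ?_)
  rw [Real.sqrt_mul (div_nonneg hK hc.le), Real.sqrt_eq_rpow ((n : ℝ) ^ (b - s)), ← Real.rpow_mul hn0.le]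
  congr 1
  congr 1
  ring

/-! ### Non-coalescence at `p` ⇒ volume tail at `p` -/

/-- **Mirror non-coalescence with exponent `b` at a parameter `p > 0` gives the half-space volume tail
`w_p(n) ≤ √(K/c) · n^{-(1/2−b)/2}`** (`K = 396 √(1/p)`): mirror independence + STUB 1 turn
`P(volUp n ∩ volDn n)` into `w_p(n)²`, the hypothesis and STUB 2 bound `c n^{-b} w_p(n)²` by
`P_p(𝒮_{e,n})`, two-ghost bounds that by `K n^{-1/2}`, and `tail_bound_of_sq_bound` takes the square
root. Valid at every `p ∈ (0,1]`; no positivity of `1/2 − b` is needed for the inequality itself. -/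
theorem volumeTail_of_nonCoalescenceAt (p : unitInterval) (hp : 0 < (p : ℝ)) {b c : ℝ} (hc : 0 < c)
    (h : ∀ n : ℕ, 1 ≤ n →
      c * (n : ℝ) ^ (-b) * (bondPercolation (zdGraph 3) p).real
          ({ω | (n : ℕ∞) ≤ (openClusterIn (withinGraph (zdGraph 3) {x : Site 3 | 1 ≤ x 0}) ω (Pi.single 0 1)).encard} ∩
            {ω | (n : ℕ∞) ≤ (openClusterIn (withinGraph (zdGraph 3) {x : Site 3 | x 0 ≤ 0}) ω 0).encard}) ≤
        (bondPercolation (zdGraph 3) p).real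
          ({ω | (n : ℕ∞) ≤ (openClusterIn (withinGraph (zdGraph 3) {x : Site 3 | 1 ≤ x 0}) ω (Pi.single 0 1)).encard} ∩
              {ω | (n : ℕ∞) ≤ (openClusterIn (withinGraph (zdGraph 3) {x : Site 3 | x 0 ≤ 0}) ω 0).encard} ∩
            {ω | ¬ (openGraph ω).Reachable (0 : Site 3) (Pi.single 0 1)})) :
    ∀ n : ℕ, 1 ≤ n →
      (bondPercolation (halfSpaceGraph 3) p).real (clusterSizeGe (halfSpaceOrigin 3) n) ≤
        Real.sqrt (66 * (2 * (3 : ℝ)) * Real.sqrt (1 / (p : ℝ)) / c) * (n : ℝ) ^ (-((1 / 2 - b) / 2)) := by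
  intro n hn
  set K : ℝ := 66 * (2 * (3 : ℝ)) * Real.sqrt (1 / (p : ℝ)) with hK
  have hK0 : 0 ≤ K := by positivity
  set w : ℝ := (bondPercolation (halfSpaceGraph 3) p).real (clusterSizeGe (halfSpaceOrigin 3) n) with hw
  have hsq : (bondPercolation (zdGraph 3) p).real
      ({ω | (n : ℕ∞) ≤ (openClusterIn (withinGraph (zdGraph 3) {x : Site 3 | 1 ≤ x 0}) ω (Pi.single 0 1)).encard} ∩
        {ω | (n : ℕ∞) ≤ (openClusterIn (withinGraph (zdGraph 3) {x : Site 3 | x 0 ≤ 0}) ω 0).encard}) = w ^ 2 := by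
    rw [mirrorIndep, (stub_mirrorSymm p n).1, (stub_mirrorSymm p n).2, sq]
  have hchain : c * (n : ℝ) ^ (-b) * w ^ 2 ≤ K * (n : ℝ) ^ (-(1 / 2 : ℝ)) := by
    calc c * (n : ℝ) ^ (-b) * w ^ 2
        = c * (n : ℝ) ^ (-b) * (bondPercolation (zdGraph 3) p).real
            ({ω | (n : ℕ∞) ≤ (openClusterIn (withinGraph (zdGraph 3) {x : Site 3 | 1 ≤ x 0}) ω (Pi.single 0 1)).encard} ∩
              {ω | (n : ℕ∞) ≤ (openClusterIn (withinGraph (zdGraph 3) {x : Site 3 | x 0 ≤ 0}) ω 0).encard}) := by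
          rw [hsq]
      _ ≤ _ := h n hn
      _ ≤ _ := stub_mirrorTwoGhost p n
      _ ≤ 66 * (2 * (3 : ℝ)) * Real.sqrt ((1 - (p : ℝ)) / ((p : ℝ) * n)) := twoGhost_bound p hp n hn
      _ ≤ 66 * (2 * (3 : ℝ)) * (Real.sqrt (1 / (p : ℝ)) * (n : ℝ) ^ (-(1 / 2 : ℝ))) :=
          mul_le_mul_of_nonneg_left (sqrt_ratio_le p hp n hn) (by norm_num)
      _ = K * (n : ℝ) ^ (-(1 / 2 : ℝ)) := by rw [hK]; ring
  exact tail_bound_of_sq_bound hn measureReal_nonneg hc hK0 hchain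

end QuantitativeBGNMirrorTransfer

open QuantitativeBGNMirrorTransfer

/-- **`MirrorNonCoalescence(b < 1/2)` at `p_c` ⇒ `QuantitativeBGN`** (the transfer of line
`mirror-akn-two-arm-import`): if at `p_c(ℤ³)` the two independent mirror half-space clusters of volume
`≥ n` (the `{x₀ ≥ 1}`-cluster of `e₀` and the `{x₀ ≤ 0}`-cluster of `0`) are bulk-DISTINCT with
conditional probability `≥ c n^{-b}`, `b < 1/2`, then the boundary one-arm probability at `p_c` decays
polynomially, with exponent `a = (1/2 − b)/2 > 0`. The hypothesis is the (open) registered stub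
`stub_mirrorNonCoalescence`, verbatim; the proof is mirror independence + the landed STUBS 1–2 +
Hutchcroft's two-ghost inequality (in tree) + the squaring algebra + the landed station
`quantitativeBGN_of_surfaceVolumeTail` (arm ⊆ volume). Uses `0 < p_c(ℤ³)` (`criticalProb_zd_pos`).
[cite: Hutchcroft2020Locality, Corollary 1.7 (the two-ghost input; the squaring is this file's)] -/
theorem quantitativeBGN_of_mirrorNonCoalescence :
    (∃ b c : ℝ, b < 1 / 2 ∧ 0 < c ∧ ∀ n : ℕ, 1 ≤ n → c * (n : ℝ) ^ (-b) *
      (Literature.Probability.Percolation.bondPercolation (Literature.Probability.LatticeModels.zdGraph 3)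
        (Literature.Probability.Percolation.criticalProbI 3)).real
        ({ω | (n : ℕ∞) ≤ (Literature.Probability.Percolation.openClusterIn
            (Literature.Probability.Percolation.withinGraph (Literature.Probability.LatticeModels.zdGraph 3)
              {x : Literature.Probability.LatticeModels.Site 3 | 1 ≤ x 0}) ω (Pi.single 0 1)).encard} ∩
          {ω | (n : ℕ∞) ≤ (Literature.Probability.Percolation.openClusterIn
            (Literature.Probability.Percolation.withinGraph (Literature.Probability.LatticeModels.zdGraph 3)
              {x : Literature.Probability.LatticeModels.Site 3 | x 0 ≤ 0}) ω 0).encard}) ≤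
      (Literature.Probability.Percolation.bondPercolation (Literature.Probability.LatticeModels.zdGraph 3)
        (Literature.Probability.Percolation.criticalProbI 3)).real
        ({ω | (n : ℕ∞) ≤ (Literature.Probability.Percolation.openClusterIn
            (Literature.Probability.Percolation.withinGraph (Literature.Probability.LatticeModels.zdGraph 3)
              {x : Literature.Probability.LatticeModels.Site 3 | 1 ≤ x 0}) ω (Pi.single 0 1)).encard} ∩
            {ω | (n : ℕ∞) ≤ (Literature.Probability.Percolation.openClusterIn
              (Literature.Probability.Percolation.withinGraph (Literature.Probability.LatticeModels.zdGraph 3)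
                {x : Literature.Probability.LatticeModels.Site 3 | x 0 ≤ 0}) ω 0).encard} ∩
          {ω | ¬ (Literature.Probability.Percolation.openGraph ω).Reachable
            (0 : Literature.Probability.LatticeModels.Site 3) (Pi.single 0 1)})) →
      Summit.CriticalPhenomena.PercolationContinuityZ3.Theses.PercLowPointHalfSpace.QuantitativeBGN := by
  rintro ⟨b, c, hb, hc, h⟩
  have hpc : 0 < ((criticalProbI 3 : unitInterval) : ℝ) := criticalProb_zd_pos 3 (by norm_num)
  have hvol := volumeTail_of_nonCoalescenceAt (criticalProbI 3) hpc hc h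
  exact quantitativeBGN_of_surfaceVolumeTail ⟨(1 / 2 - b) / 2, _, by linarith, hvol⟩

/-- **The open stub is false above `p_c`** (load-bearing use of `p ≤ p_c`): for `p > p_c(ℤ³)`, mirror
non-coalescence with an exponent `b < 1/2` would give, by the same squaring, a polynomial volume tail and
hence (`stub_armToSurfaceTail`) a polynomial decay of the half-space arm probability at `p`, i.e.
`QuantitativeBGNAt p` — refuted by `Negative.quantitativeBGNAt_false_of_criticalProb_lt` (`θ_H(p) > 0`). -/
theorem mirrorNonCoalescence_false_of_criticalProb_lt (p : unitInterval)
    (hp : criticalProb (zdGraph 3) (0 : Site 3) < p) :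
    ¬ (∃ b c : ℝ, b < 1 / 2 ∧ 0 < c ∧ ∀ n : ℕ, 1 ≤ n → c * (n : ℝ) ^ (-b) *
      (bondPercolation (zdGraph 3) p).real
        ({ω | (n : ℕ∞) ≤ (openClusterIn (withinGraph (zdGraph 3) {x : Site 3 | 1 ≤ x 0}) ω (Pi.single 0 1)).encard} ∩
          {ω | (n : ℕ∞) ≤ (openClusterIn (withinGraph (zdGraph 3) {x : Site 3 | x 0 ≤ 0}) ω 0).encard}) ≤
      (bondPercolation (zdGraph 3) p).real
        ({ω | (n : ℕ∞) ≤ (openClusterIn (withinGraph (zdGraph 3) {x : Site 3 | 1 ≤ x 0}) ω (Pi.single 0 1)).encard} ∩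
            {ω | (n : ℕ∞) ≤ (openClusterIn (withinGraph (zdGraph 3) {x : Site 3 | x 0 ≤ 0}) ω 0).encard} ∩
          {ω | ¬ (openGraph ω).Reachable (0 : Site 3) (Pi.single 0 1)})) := by
  rintro ⟨b, c, hb, hc, h⟩
  have hp0 : 0 < (p : ℝ) := (criticalProb_zd_pos 3 (by norm_num)).trans hp
  have hvol := volumeTail_of_nonCoalescenceAt p hp0 hc h
  exact QuantitativeBGN.Negative.quantitativeBGNAt_false_of_criticalProb_lt p hp
    ⟨(1 / 2 - b) / 2, Real.sqrt (66 * (2 * (3 : ℝ)) * Real.sqrt (1 / (p : ℝ)) / c), by linarith,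
      fun r hr => (stub_armToSurfaceTail p r).trans (hvol r hr)⟩

/-- **Thin-footed large half-space clusters are polynomially rare (unconditional).** For `0 < p`,
`n ≥ 1` and every `k`:
`(1 − p)^k · P_p(volDn n ∩ footLe k)² ≤ 396 √((1−p)/(pn))`, where `volDn n = {n ≤ |C_{H⁻}(0)|}`,
`H⁻ = withinGraph (zdGraph 3) {x₀ ≤ 0}`, and `footLe k = {|C_{H⁻}(0) ∩ {x₀ = 0}| ≤ k}` (the cluster
touches the boundary plane in at most `k` sites). Proof: `mirror_sealing_bound` (finite energy + sealing),
`P(volUp n) = P(volDn n) ≥ P(volDn n ∩ footLe k)` (STUB 1), `stub_mirrorTwoGhost` and two-ghost. At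
`p = p_c(ℤ³)` this reads `P(|C_H(0)| ≥ n, |foot| ≤ k) ≤ 20 (1−p_c)^{-k/2} n^{-1/4} p_c^{-1/4}`. -/
theorem mirror_thinFoot_bound (p : unitInterval) (hp : 0 < (p : ℝ)) (n : ℕ) (hn : 1 ≤ n) (k : ℕ) :
    (1 - (p : ℝ)) ^ k *
        (bondPercolation (zdGraph 3) p).real
          ({ω | (n : ℕ∞) ≤ (openClusterIn (withinGraph (zdGraph 3) {x : Site 3 | x 0 ≤ 0}) ω 0).encard} ∩
            {ω | (openClusterIn (withinGraph (zdGraph 3) {x : Site 3 | x 0 ≤ 0}) ω 0 ∩ {x : Site 3 | x 0 = 0}).encard ≤ k}) ^ 2 ≤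
      66 * (2 * (3 : ℝ)) * Real.sqrt ((1 - (p : ℝ)) / ((p : ℝ) * n)) := by
  set P := bondPercolation (zdGraph 3) p with hP
  set Up : Set (BondConfig (Site 3)) :=
    {ω | (n : ℕ∞) ≤ (openClusterIn (withinGraph (zdGraph 3) {x : Site 3 | 1 ≤ x 0}) ω (Pi.single 0 1)).encard} with hUp
  set Dn : Set (BondConfig (Site 3)) :=
    {ω | (n : ℕ∞) ≤ (openClusterIn (withinGraph (zdGraph 3) {x : Site 3 | x 0 ≤ 0}) ω 0).encard} with hDn
  set Ft : Set (BondConfig (Site 3)) :=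
    {ω | (openClusterIn (withinGraph (zdGraph 3) {x : Site 3 | x 0 ≤ 0}) ω 0 ∩ {x : Site 3 | x 0 = 0}).encard ≤ k} with hFt
  have hk : 0 ≤ (1 - (p : ℝ)) ^ k := pow_nonneg (sub_nonneg.2 p.2.2) k
  -- `P(volDn ∩ footLe) ≤ P(volDn) = P(volUp)`
  have hle : P.real (Dn ∩ Ft) ≤ P.real Up := by
    rw [(stub_mirrorSymm p n).1, ← (stub_mirrorSymm p n).2]
    exact measureReal_mono Set.inter_subset_left
  calc (1 - (p : ℝ)) ^ k * P.real (Dn ∩ Ft) ^ 2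
      = (1 - (p : ℝ)) ^ k * (P.real (Dn ∩ Ft) * P.real (Dn ∩ Ft)) := by rw [sq]
    _ ≤ (1 - (p : ℝ)) ^ k * (P.real Up * P.real (Dn ∩ Ft)) :=
        mul_le_mul_of_nonneg_left (mul_le_mul_of_nonneg_right hle measureReal_nonneg) hk
    _ ≤ P.real (Up ∩ Dn ∩ {ω | ¬ (openGraph ω).Reachable (0 : Site 3) (Pi.single 0 1)}) :=
        mirror_sealing_bound p n k
    _ ≤ _ := stub_mirrorTwoGhost p n
    _ ≤ _ := twoGhost_bound p hp n hn

end Summit.CriticalPhenomena.PercolationContinuityZ3.Theorems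

end
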